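import Summits.ABC.ABC.Theorems.PrimePowerRadical.Negative.WithoutEps
import Literature.NumberTheory.DiophantineGeometry.StewartPadicOrder

/-!
# `PrimePowerRadical` (stmt-ABC-1648): exact valuations of `q^k − 1` and the Wieferich sandwich

Negative-side support for the crux `Summit.ABC.ABC.Theses.IneffectiveSubspace.PrimePowerRadical` (cdisprove seat).
For a prime `p` put `W_p(q) := v_p(q^{2(p−1)} − 1)` (`wieferichLevel q p`; for odd `p ∤ q` this is
`v_p(q^{p−1} − 1) ≥ 1`, and `≥ 2` iff `p` is a Wieferich prime to base `q`). Lifting the exponent gives the EXACT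
valuations along the family: `v_p(q^k − 1) = W_p(q) + v_p(k)` for odd `p ∣ q^k − 1` (`padicValNat_family`) and
`v_2(q^k − 1) ≤ W_2(q) + v_2(k)` (`padicValNat_two_family_le`). With the ODD WIEFERICH EXCESS
`E_W(q,k) := ∏_{p ∣ q^k − 1, p ≠ 2} p^{W_p(q) − 1}` (`oddWieferichExcess`) this yields the sandwich
`E_W · rad(q^k − 1) ∣ q^k − 1 ∣ k · rad(q^k − 1) · E_W · 2^{W_2}` (`oddWieferichExcess_mul_radical_dvd`,
`dvd_mul_oddWieferichExcess`): up to the factor `k · 2^{W_2}` the powerful excess `(q^k − 1)/rad(q^k − 1)` IS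
the Wieferich excess. The equivalence "crux ⟺ Wieferich sparsity" built on this is in
`Negative/WieferichSparse.lean`.
-/

noncomputable section

namespace Summit.ABC.ABC.Theorems.PrimePowerRadical.Negative

open Literature.NumberTheory.DiophantineGeometry UniqueFactorizationMonoid

/-- The Wieferich level of the prime `p` to base `q`: `v_p(q^{2(p−1)} − 1)`. [folklore] -/
def wieferichLevel (q p : ℕ) : ℕ := padicValNat p (q ^ (2 * (p - 1)) - 1)

/-- For a prime `p ∤ q`: `p ∣ q^{2(p−1)} − 1` (Fermat), so `W_p(q) ≥ 1`. [folklore] -/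
theorem dvd_pow_two_mul_sub_one {q p : ℕ} (hp : p.Prime) (hq : 1 ≤ q) (hpq : ¬ p ∣ q) :
    p ∣ q ^ (2 * (p - 1)) - 1 := by
  have h1 : p ∣ q ^ (p - 1) - 1 ^ (p - 1) :=
    Dioph.prime_dvd_pow_sub_pow_fermat hp hpq (fun h => hp.one_lt.ne' (Nat.dvd_one.mp h)) hq
  have h2 : q ^ (p - 1) - 1 ∣ q ^ (2 * (p - 1)) - 1 := by
    have := Nat.sub_dvd_pow_sub_pow (q ^ (p - 1)) 1 2
    rwa [one_pow, ← pow_mul, mul_comm] at this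
  exact dvd_trans (by simpa using h1) h2

/-- `W_p(q) ≥ 1` for a prime `p ∤ q`, `q ≥ 2`. [folklore] -/
theorem one_le_wieferichLevel {q p : ℕ} (hp : p.Prime) (hq : 2 ≤ q) (hpq : ¬ p ∣ q) :
    1 ≤ wieferichLevel q p := by
  haveI := Fact.mk hp
  have hne : q ^ (2 * (p - 1)) - 1 ≠ 0 := by
    have : 2 ≤ q ^ (2 * (p - 1)) := two_le_pow hq (by have := hp.two_le; omega)
    omega
  exact one_le_padicValNat_of_dvd hne (dvd_pow_two_mul_sub_one hp (by omega) hpq)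

/-- A prime factor of `q^k − 1` does not divide `q`. [folklore] -/
theorem not_dvd_base_of_dvd {q p k : ℕ} (hp : p.Prime) (hk : 1 ≤ k) (hq : 1 ≤ q)
    (hpk : p ∣ q ^ k - 1) : ¬ p ∣ q := by
  intro h
  have h1 : p ∣ q ^ k := dvd_pow h (by omega)
  have h1' : 1 ≤ q ^ k := Nat.one_le_pow _ _ (by omega)
  have h2 : p ∣ q ^ k - (q ^ k - 1) := Nat.dvd_sub h1 hpk
  rw [Nat.sub_sub_self h1'] at h2
  exact hp.one_lt.ne' (Nat.dvd_one.mp h2)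

/-- **Exact valuations along the family (LTE).** For `q ≥ 2`, an odd prime `p ∣ q^k − 1`, `k ≥ 1`:
`v_p(q^k − 1) = W_p(q) + v_p(k)`. (No multiplicative order is needed: compute `v_p(q^{2(p−1)k} − 1)`
by lifting from `q^k` and from `q^{2(p−1)}`.) [folklore] -/
theorem padicValNat_family {q p k : ℕ} (hq : 2 ≤ q) (hp : p.Prime) (hp2 : p ≠ 2) (hk : 1 ≤ k)
    (hpk : p ∣ q ^ k - 1) :
    padicValNat p (q ^ k - 1) = wieferichLevel q p + padicValNat p k := by
  haveI := Fact.mk hp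
  have hp1 : Odd p := hp.odd_of_ne_two hp2
  have hpq : ¬ p ∣ q := not_dvd_base_of_dvd hp hk (by omega) hpk
  have hn0 : 2 * (p - 1) ≠ 0 := by have := hp.two_le; omega
  have hp21 : ¬ p ∣ 2 * (p - 1) := by
    intro h
    rcases (Nat.Prime.dvd_mul hp).mp h with h2 | h2
    · exact hp2 ((Nat.prime_dvd_prime_iff_eq hp Nat.prime_two).mp h2)
    · have := Nat.le_of_dvd (by have := hp.two_le; omega) h2
      omega
  -- x = q^k
  set x := q ^ k with hx
  have hx1 : 1 < x := by have := two_le_pow hq hk; omega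
  have hpx : ¬ p ∣ x := fun h => hpq (hp.dvd_of_dvd_pow h)
  have hA : padicValNat p (x ^ (2 * (p - 1)) - 1) = padicValNat p (x - 1) := by
    have h := padicValNat.pow_sub_pow hp1 hx1 hpk hpx hn0
    rw [one_pow, padicValNat.eq_zero_of_not_dvd hp21, add_zero] at h
    exact h
  -- y = q^(2(p-1))
  set y := q ^ (2 * (p - 1)) with hy
  have hy1 : 1 < y := Nat.one_lt_pow hn0 (by omega)
  have hpy : ¬ p ∣ y := fun h => hpq (hp.dvd_of_dvd_pow h)
  have hpy1 : p ∣ y - 1 := dvd_pow_two_mul_sub_one hp (by omega) hpq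
  have hB : padicValNat p (y ^ k - 1) = padicValNat p (y - 1) + padicValNat p k := by
    have h := padicValNat.pow_sub_pow hp1 hy1 hpy1 hpy (by omega : k ≠ 0)
    rwa [one_pow] at h
  have hC : x ^ (2 * (p - 1)) = y ^ k := by
    rw [hx, hy, ← pow_mul, ← pow_mul, mul_comm]
  rw [hC] at hA
  unfold wieferichLevel
  rw [← hy]
  omega

/-- **The `2`-adic valuation along the family** (`q` odd, `k ≥ 1`): `v_2(q^k − 1) ≤ W_2(q) + v_2(k)`
(equality `+1` on the left for even `k`; for odd `k` the truth is `v_2(q − 1)`). [folklore] -/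
theorem padicValNat_two_family_le {q k : ℕ} (hq : 2 ≤ q) (hq2 : ¬ 2 ∣ q) (hk : 1 ≤ k) :
    padicValNat 2 (q ^ k - 1) ≤ wieferichLevel q 2 + padicValNat 2 k := by
  have hq1 : 1 < q := by omega
  have hdvd : q ^ k - 1 ∣ q ^ (2 * k) - 1 := by
    have := Nat.sub_dvd_pow_sub_pow (q ^ k) 1 2
    rwa [one_pow, ← pow_mul, mul_comm] at this
  have hne : q ^ (2 * k) - 1 ≠ 0 := by
    have := two_le_pow hq (by omega : 1 ≤ 2 * k); omega
  have h1 : padicValNat 2 (q ^ k - 1) ≤ padicValNat 2 (q ^ (2 * k) - 1) :=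
    (padicValNat_dvd_iff_le hne).mp (dvd_trans pow_padicValNat_dvd hdvd)
  have h2 := padicValNat.pow_two_sub_one hq1 hq2 (by omega : 2 * k ≠ 0) (even_two_mul k)
  have h3 := padicValNat.pow_two_sub_one hq1 hq2 (by norm_num : 2 ≠ 0) even_two
  have h4 : padicValNat 2 (2 * k) = 1 + padicValNat 2 k := by
    rw [padicValNat.mul (by norm_num) (by omega)]; simp
  have h5 : padicValNat 2 2 = 1 := by simp
  have hW : wieferichLevel q 2 = padicValNat 2 (q ^ 2 - 1) := by simp [wieferichLevel]
  omega

/-- The ODD WIEFERICH EXCESS of `q^k − 1`: `∏_{p ∣ q^k − 1, p ≠ 2} p^{W_p(q) − 1}`; only Wieferich primes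
to base `q` (`W_p ≥ 2`) contribute a factor `> 1`. [folklore] -/
def oddWieferichExcess (q k : ℕ) : ℕ :=
  ∏ p ∈ (q ^ k - 1).primeFactors.erase 2, p ^ (wieferichLevel q p - 1)

/-- The odd Wieferich excess is positive. [folklore] -/
theorem oddWieferichExcess_pos (q k : ℕ) : 0 < oddWieferichExcess q k := by
  unfold oddWieferichExcess
  exact Finset.prod_pos fun p hp =>
    pow_pos (Nat.prime_of_mem_primeFactors (Finset.mem_of_mem_erase hp)).pos _

/-- Factorisation of a product of prime powers over a finset of primes. [folklore] -/
theorem factorization_prod_prime_pow {S : Finset ℕ} (hS : ∀ r ∈ S, r.Prime) (e : ℕ → ℕ) (p : ℕ) :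
    (∏ r ∈ S, r ^ e r).factorization p = if p ∈ S then e p else 0 := by
  rw [Nat.factorization_prod fun r hr => pow_ne_zero _ (hS r hr).ne_zero, Finsupp.finsetSum_apply,
    Finset.sum_congr rfl fun r hr => by rw [(hS r hr).factorization_pow, Finsupp.single_apply]]
  exact Finset.sum_ite_eq' S p e

/-- Factorisation of the odd Wieferich excess. [folklore] -/
theorem factorization_oddWieferichExcess (q k p : ℕ) :
    (oddWieferichExcess q k).factorization p =
      if p ∈ (q ^ k - 1).primeFactors.erase 2 then wieferichLevel q p - 1 else 0 :=
  factorization_prod_prime_pow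
    (fun _ hr => Nat.prime_of_mem_primeFactors (Finset.mem_of_mem_erase hr)) _ p

/-- Factorisation of the radical: `1` on the prime factors, `0` elsewhere. [folklore] -/
theorem factorization_radical (n p : ℕ) :
    (radical n).factorization p = if p ∈ n.primeFactors then 1 else 0 := by
  rw [Nat.radical_eq_prod_primeFactors,
    Finset.prod_congr rfl fun r _ => (pow_one r).symm]
  exact factorization_prod_prime_pow (fun r hr => Nat.prime_of_mem_primeFactors hr) (fun _ => 1) p

/-- **Lower half of the sandwich**: `E_W(q,k) · rad(q^k − 1) ∣ q^k − 1` (the Wieferich levels are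
really present in `q^k − 1`). [folklore] -/
theorem oddWieferichExcess_mul_radical_dvd {q k : ℕ} (hq : 2 ≤ q) (hk : 1 ≤ k) :
    oddWieferichExcess q k * radical (q ^ k - 1) ∣ q ^ k - 1 := by
  have hn : q ^ k - 1 ≠ 0 := by have := two_le_pow hq hk; omega
  have hE := (oddWieferichExcess_pos q k).ne'
  have hR : radical (q ^ k - 1) ≠ 0 := radical_ne_zero
  rw [← Nat.factorization_le_iff_dvd (mul_ne_zero hE hR) hn, Nat.factorization_mul hE hR,
    Finsupp.le_def]
  intro p
  rw [Finsupp.add_apply, factorization_oddWieferichExcess, factorization_radical]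
  by_cases hpP : p ∈ (q ^ k - 1).primeFactors
  · have hp : p.Prime := Nat.prime_of_mem_primeFactors hpP
    have hpk : p ∣ q ^ k - 1 := Nat.dvd_of_mem_primeFactors hpP
    haveI := Fact.mk hp
    rw [if_pos hpP, Nat.factorization_def _ hp]
    by_cases hp2 : p = 2
    · subst hp2
      rw [if_neg (by simp)]
      simpa using one_le_padicValNat_of_dvd hn hpk
    · rw [if_pos (Finset.mem_erase.mpr ⟨hp2, hpP⟩), padicValNat_family hq hp hp2 hk hpk]
      have := one_le_wieferichLevel hp hq (not_dvd_base_of_dvd hp hk (by omega) hpk)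
      omega
  · have h1 : p ∉ (q ^ k - 1).primeFactors.erase 2 := fun h => hpP (Finset.mem_of_mem_erase h)
    rw [if_neg h1, if_neg hpP]
    simp

/-- **Upper half of the sandwich**: `q^k − 1 ∣ k · rad(q^k − 1) · E_W(q,k) · 2^{W_2(q)}` — beyond the
radical, `q^k − 1` contains only the Wieferich excess, the `v_p(k)` parts (total `≤ k`) and a bounded
power of `2`. [folklore] -/
theorem dvd_mul_oddWieferichExcess {q k : ℕ} (hq : q.Prime) (hk : 1 ≤ k) :
    q ^ k - 1 ∣ k * radical (q ^ k - 1) * oddWieferichExcess q k * 2 ^ wieferichLevel q 2 := by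
  have hq2 := hq.two_le
  have hn : q ^ k - 1 ≠ 0 := by have := two_le_pow hq2 hk; omega
  have hE := (oddWieferichExcess_pos q k).ne'
  have hR : radical (q ^ k - 1) ≠ 0 := radical_ne_zero
  have hk0 : k ≠ 0 := by omega
  have h2W : 2 ^ wieferichLevel q 2 ≠ 0 := pow_ne_zero _ two_ne_zero
  rw [← Nat.factorization_le_iff_dvd hn
      (mul_ne_zero (mul_ne_zero (mul_ne_zero hk0 hR) hE) h2W),
    Nat.factorization_mul (mul_ne_zero (mul_ne_zero hk0 hR) hE) h2W,
    Nat.factorization_mul (mul_ne_zero hk0 hR) hE, Nat.factorization_mul hk0 hR, Finsupp.le_def]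
  intro p
  simp only [Finsupp.add_apply]
  rw [factorization_oddWieferichExcess, factorization_radical, Nat.prime_two.factorization_pow,
    Finsupp.single_apply]
  by_cases hpP : p ∈ (q ^ k - 1).primeFactors
  · have hp : p.Prime := Nat.prime_of_mem_primeFactors hpP
    have hpk : p ∣ q ^ k - 1 := Nat.dvd_of_mem_primeFactors hpP
    haveI := Fact.mk hp
    rw [if_pos hpP, Nat.factorization_def _ hp, Nat.factorization_def _ hp]
    by_cases hp2 : p = 2
    · subst hp2
      rw [if_neg (by simp), if_pos rfl]
      have hqodd : ¬ 2 ∣ q := fun h =>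
        (not_dvd_base_of_dvd Nat.prime_two hk (by omega) hpk) h
      have := padicValNat_two_family_le hq2 hqodd hk
      omega
    · rw [if_pos (Finset.mem_erase.mpr ⟨hp2, hpP⟩), if_neg (Ne.symm hp2),
        padicValNat_family hq2 hp hp2 hk hpk]
      have := one_le_wieferichLevel hp hq2 (not_dvd_base_of_dvd hp hk (by omega) hpk)
      omega
  · by_cases hp : p.Prime
    · rw [Nat.factorization_def _ hp,
        padicValNat.eq_zero_of_not_dvd fun h => hpP (Nat.mem_primeFactors.mpr ⟨hp, h, hn⟩)]
      exact Nat.zero_le _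
    · simp [Nat.factorization_eq_zero_of_not_prime _ hp]

/-- The sandwich in `ℕ`-inequality form: `E_W · rad ≤ q^k − 1 ≤ k · rad · E_W · 2^{W_2}`. [folklore] -/
theorem oddWieferichExcess_sandwich {q k : ℕ} (hq : q.Prime) (hk : 1 ≤ k) :
    oddWieferichExcess q k * radical (q ^ k - 1) ≤ q ^ k - 1 ∧
      q ^ k - 1 ≤ k * radical (q ^ k - 1) * oddWieferichExcess q k * 2 ^ wieferichLevel q 2 := by
  have hn : 0 < q ^ k - 1 := by have := two_le_pow hq.two_le hk; omega
  refine ⟨Nat.le_of_dvd hn (oddWieferichExcess_mul_radical_dvd hq.two_le hk),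
    Nat.le_of_dvd ?_ (dvd_mul_oddWieferichExcess hq hk)⟩
  have := oddWieferichExcess_pos q k
  have : 0 < radical (q ^ k - 1) := Nat.radical_pos _
  positivity

end Summit.ABC.ABC.Theorems.PrimePowerRadical.Negative

end
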